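import Mathlib

/-!
# `BalabanUV.Beta.FP.TowerK2bStoreyBridge` — road «FP», binder row D1, ROUTE T (β1): **TWO FACTS ABOUT THE END WRAPPER's DISPLAYED WARD ROW (K2b)** —
# §0a the STOREYWISE pure-gauge row (top brick commutated with the ROOT-sampled gauge function between two transports + the top linear brick times the
# lower storeys' rows) together with the constraint Hessian's STOREY SPLIT is EXACTLY the wrapper's shape `κ₂ • (E_λ·Ĉ − Ĉ·E_λ) + Σ_s λ s • Rs s` with `κ₂ = −w`
# and the EXPLICIT remainder `Rs` = the transport-variation word `L̃(b;x)·(𝟙[x.1 = s] − 𝟙[root b = s])` on either leg of the top brick + the lower remainders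
# through the top linear brick (`storeyRow_eq_commutator_add_remainder`; `…_window` = the same with an2's window presentation `Σ_κ Σ_{e ∈ offs}`); §0b the wrapper's (K2b) WITH A FREE `Rs` CARRIES NO CONTENT: the defect
# `Def λ := Σ_b (Dλ)_b • ℳ̂₂ b − κ₂•(E_λ·Ĉ − Ĉ·E_λ)` is linear in `λ`, so `Rs s := Def 𝟙_s` inhabits it identically (`wardRow_of_defect`, `sum_smul_defect_indicator`)
# — all order-2 H-side content of v5…v7 at composite depth is the VALUE of `Def` at the road's read-outs, i.e. the residual row (J-R₂) (`g47/SPEC-59.md`)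

WHY (journal [D1P3-G47-ONLINE] W-1, [AN2-G71-RCPT-2], [D1P3-G47-PROPOSED-1]).  The END wrapper v6∕v7 displays (K2b) as `Σ_b (Dλ)_b • ℳ̂₂ b β = κ₂ • (E_λ·Ĉ_β −
Ĉ_β·E_λ) + Σ_s λ s • Rs s β` with a FREE site-remainder family `Rs`; an2's kernel theorems give the LEFT side in STOREYWISE form (PART 26 depth 1, PART 31d depth 2,
PART 33c every depth — `torus_compM2even_pureGauge_fst_fun(_succ)`) and PART 34 `CombHessStoreySplitTorus` splits `Ĉ_β` by storeys: §0a is the bridge between the two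
currencies (one induction over the depth at the wrapper's letters instantiates it — §1, a later file, once PART 31d∕33c∕34 are in the tree); §0b is why v8 drops (K2b).
Pure `Matrix`∕`Finset` algebra over abstract finite index types; no literal object.  [folklore] bookkeeping; no `def`, no `def … : Prop`, nothing cited, 0 sorry.
Nothing of Bałaban's asserted, valued or discharged; 0 estimates; 0∕4 row-D1 binders (hW, hR, D1Tel, D1Rep); NOT (C1), NOT (T-ID), NOT D1, NOT BetaPertH, NOT
continuum, NOT Clay.

HONEST DEPENDENCY (page 1, mandatory): continuum YM on T⁴ ⇐ BetaPertH ∧ nine spine estimates (0/9 proved); BetaPertH ⇐ (D1) ∧ (D4) ∧ CAP+tail;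
G-an2-4 gates asym, D1 and NE2/3/4.  HONEST FRAMING (cell contract, verbatim): «discharging `BetaPertH` makes Bałaban's UV stability UNCONDITIONAL —
a real constructive-QFT result; it is NOT the continuum limit and NOT the Clay problem.»  ABSOLUTE RULE (cell charter, verbatim): «No internally-minted
statement may enter as a cited fact. Every hypothesis is either kernel-proved in this package or a verbatim quotation of a PUBLISHED theorem with page
reference. The manuscript(s) under audit are NOT citable for their own disputed steps — they are the thing under adjudication; programme-internal
(2001/route/tribunal) claims are never citable.»  Road «FP» OWNER, b2b-balaban-beta-d1-p3 gen 47, 2026-08-28.  No existing file touched.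
-/

noncomputable section

open scoped BigOperators

namespace Summit.QuantumFields.BalabanUV.Beta.FP.TowerK2bStoreyBridge

open Finset Matrix

section Algebra

variable {ι σ τ : Type*} [Fintype ι] [DecidableEq ι] [Fintype σ] [DecidableEq σ] [Fintype τ]

/-- [folklore] a diagonal times a rank-one matrix scales the left vector. -/
theorem diagonal_mul_vecMulVec (d u v : ι → ℝ) :
    Matrix.diagonal d * Matrix.vecMulVec u v = Matrix.vecMulVec (fun x => d x * u x) v := by
  ext x z
  simp only [Matrix.mul_apply, Matrix.diagonal_apply, Matrix.vecMulVec_apply, ite_mul, zero_mul, Finset.sum_ite_eq, Finset.mem_univ, if_true]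
  ring

/-- [folklore] a rank-one matrix times a diagonal scales the right vector. -/
theorem vecMulVec_mul_diagonal (d u v : ι → ℝ) :
    Matrix.vecMulVec u v * Matrix.diagonal d = Matrix.vecMulVec u (fun z => v z * d z) := by
  ext x z
  simp only [Matrix.mul_apply, Matrix.diagonal_apply, Matrix.vecMulVec_apply, mul_ite, mul_zero, Finset.sum_ite_eq', Finset.mem_univ, if_true]
  ring

/-- [folklore] the LEFT-leg transport-variation word summed against the gauge function: `Σ_s λ s • ((𝟙[pr · = s] − 𝟙[r = s])·u) ⊗ v = E_λ·(u ⊗ v) − λ r • u ⊗ v`. -/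
theorem sum_smul_vecMulVec_indicator_left (pr : ι → σ) (lam : σ → ℝ) (r : σ) (u v : ι → ℝ) :
    ∑ s, lam s • Matrix.vecMulVec (fun x => ((if pr x = s then (1 : ℝ) else 0) - (if r = s then (1 : ℝ) else 0)) * u x) v
      = Matrix.diagonal (fun x => lam (pr x)) * Matrix.vecMulVec u v - lam r • Matrix.vecMulVec u v := by
  ext x z
  simp only [Matrix.sum_apply, Matrix.smul_apply, Matrix.sub_apply, Matrix.vecMulVec_apply, diagonal_mul_vecMulVec, smul_eq_mul, sub_mul, mul_sub,
    Finset.sum_sub_distrib, ite_mul, one_mul, zero_mul, mul_ite, mul_zero, Finset.sum_ite_eq, Finset.mem_univ, if_true]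
  ring

/-- [folklore] the RIGHT-leg transport-variation word summed against the gauge function: `Σ_s λ s • u ⊗ ((𝟙[pr · = s] − 𝟙[r = s])·v) = (u ⊗ v)·E_λ − λ r • u ⊗ v`. -/
theorem sum_smul_vecMulVec_indicator_right (pr : ι → σ) (lam : σ → ℝ) (r : σ) (u v : ι → ℝ) :
    ∑ s, lam s • Matrix.vecMulVec u (fun z => ((if pr z = s then (1 : ℝ) else 0) - (if r = s then (1 : ℝ) else 0)) * v z)
      = Matrix.vecMulVec u v * Matrix.diagonal (fun x => lam (pr x)) - lam r • Matrix.vecMulVec u v := by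
  ext x z
  simp only [Matrix.sum_apply, Matrix.smul_apply, Matrix.sub_apply, Matrix.vecMulVec_apply, vecMulVec_mul_diagonal, smul_eq_mul, sub_mul, mul_sub,
    Finset.sum_sub_distrib, ite_mul, one_mul, zero_mul, mul_ite, mul_zero, Finset.sum_ite_eq, Finset.mem_univ, if_true]
  ring

omit [Fintype ι] [DecidableEq ι] [DecidableEq σ] in
/-- [folklore] linearity bookkeeping: the gauge superposition enters the top double sum and the lower single sum termwise. -/
theorem sum_smul_top_add_low (lam : σ → ℝ) (h : τ → τ → ℝ) (ℓ : τ → ℝ) (w : ℝ) (A : σ → τ → τ → Matrix ι ι ℝ) (Rl : σ → τ → Matrix ι ι ℝ) :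
    ∑ s, lam s • (w • ∑ b₁, ∑ b₂, h b₁ b₂ • A s b₁ b₂ + ∑ b, ℓ b • Rl s b)
      = w • ∑ b₁, ∑ b₂, h b₁ b₂ • ∑ s, lam s • A s b₁ b₂ + ∑ b, ℓ b • ∑ s, lam s • Rl s b := by
  simp only [smul_add, Finset.smul_sum, smul_smul, Finset.sum_add_distrib]
  congr 1
  · rw [Finset.sum_comm]
    refine Finset.sum_congr rfl fun b₁ _ => ?_
    rw [Finset.sum_comm]
    exact Finset.sum_congr rfl fun b₂ _ => Finset.sum_congr rfl fun s _ => by rw [mul_comm (lam s), mul_assoc]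
  · rw [Finset.sum_comm]
    exact Finset.sum_congr rfl fun b _ => Finset.sum_congr rfl fun s _ => by rw [mul_comm]

/-- [folklore] **`storeyRow_eq_commutator_add_remainder` — THE STOREYWISE WARD ROW IS THE WRAPPER's COMMUTATOR ROW WITH AN EXPLICIT REMAINDER.**
Data: fine indices `ι` over sites `pr : ι → σ`, a gauge function `lam : σ → ℝ` with generator `E := diagonal (lam ∘ pr)`; the TOP storey: window bonds `τ`, the
(any-symmetry) top brick `h : τ → τ → ℝ`, transports `L : τ → ι → ℝ`, roots `rt : τ → σ`, the top linear brick `ℓ : τ → ℝ`; the LOWER storeys at the window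
bonds: tables `Cl b` whose rows are ALREADY in the wrapper's currency, `Xl b = κ • (E·Cl b − Cl b·E) + Σ_s lam s • Rl s b`.  IF the table splits by storeys,
`C = Σ_{b₁b₂} h b₁ b₂ • L b₁ ⊗ L b₂ + Σ_b ℓ b • Cl b`, and `κ = −w`, THEN the storeywise row
`w • Σ_{b₁b₂} ((lam (rt b₂) − lam (rt b₁)) * h b₁ b₂) • L b₁ ⊗ L b₂ + Σ_b ℓ b • Xl b = κ • (E·C − C·E) + Σ_s lam s • Rs s` with the EXPLICIT
`Rs s = w • Σ_{b₁b₂} h b₁ b₂ • ((𝟙[pr · = s] − 𝟙[rt b₁ = s])·L b₁ ⊗ L b₂ − L b₁ ⊗ (𝟙[pr · = s] − 𝟙[rt b₂ = s])·L b₂) + Σ_b ℓ b • Rl s b`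
(`u ⊗ v := vecMulVec u v`; the transport-variation word on either leg, plus the lower remainders through `ℓ`). -/
theorem storeyRow_eq_commutator_add_remainder (pr : ι → σ) (lam : σ → ℝ) (h : τ → τ → ℝ) (L : τ → ι → ℝ) (rt : τ → σ) (ℓ : τ → ℝ)
    (Cl Xl : τ → Matrix ι ι ℝ) (Rl : σ → τ → Matrix ι ι ℝ) (κ w : ℝ) (hκ : κ = -w)
    (hXl : ∀ b, Xl b = κ • (Matrix.diagonal (fun x => lam (pr x)) * Cl b - Cl b * Matrix.diagonal (fun x => lam (pr x))) + ∑ s, lam s • Rl s b)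
    (C : Matrix ι ι ℝ) (hC : C = ∑ b₁, ∑ b₂, h b₁ b₂ • Matrix.vecMulVec (L b₁) (L b₂) + ∑ b, ℓ b • Cl b) :
    w • ∑ b₁, ∑ b₂, ((lam (rt b₂) - lam (rt b₁)) * h b₁ b₂) • Matrix.vecMulVec (L b₁) (L b₂) + ∑ b, ℓ b • Xl b
      = κ • (Matrix.diagonal (fun x => lam (pr x)) * C - C * Matrix.diagonal (fun x => lam (pr x)))
        + ∑ s, lam s • (w • ∑ b₁, ∑ b₂, h b₁ b₂ • (Matrix.vecMulVec (fun x => ((if pr x = s then (1 : ℝ) else 0) - (if rt b₁ = s then (1 : ℝ) else 0)) * L b₁ x) (L b₂)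
              - Matrix.vecMulVec (L b₁) (fun z => ((if pr z = s then (1 : ℝ) else 0) - (if rt b₂ = s then (1 : ℝ) else 0)) * L b₂ z))
            + ∑ b, ℓ b • Rl s b) := by
  subst hκ
  -- the gauge superposition enters termwise; each leg's indicator word is `E·P − λ(root)•P` ∕ `P·E − λ(root)•P`
  rw [sum_smul_top_add_low]
  simp only [smul_sub, Finset.sum_sub_distrib, sum_smul_vecMulVec_indicator_left, sum_smul_vecMulVec_indicator_right, hXl, hC]
  -- what is left is termwise matrix algebra
  ext x z
  simp only [Matrix.add_apply, Matrix.sub_apply, Matrix.smul_apply, Matrix.sum_apply, diagonal_mul_vecMulVec, vecMulVec_mul_diagonal,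
    Matrix.sum_mul, Matrix.mul_smul, Matrix.smul_mul, Matrix.vecMulVec_apply, smul_eq_mul,
    Finset.mul_sum, Finset.sum_add_distrib, Finset.sum_sub_distrib, mul_add, mul_sub, sub_mul, add_mul, smul_add, smul_sub]
  simp only [neg_mul, mul_neg, Finset.sum_neg_distrib, mul_comm, mul_left_comm]
  abel

omit [Fintype τ] in
/-- [folklore] **`storeyRow_eq_commutator_add_remainder_window`** — the same bridge with the window bonds presented as an2's PART 31d∕33c∕34 present them:
pairs `(κ, e)` with `κ` over a finite type and `e` over a FINSET `O` (the offsets `offs Lc`), sums `Σ_κ Σ_{e∈O}`; no subtype conversion needed at the instance. -/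
theorem storeyRow_eq_commutator_add_remainder_window {K ε : Type*} [Fintype K] [DecidableEq ε] (O : Finset ε)
    (pr : ι → σ) (lam : σ → ℝ) (h : K → ε → K → ε → ℝ) (L : K → ε → ι → ℝ) (rt : K → ε → σ) (ℓ : K → ε → ℝ)
    (Cl Xl : K → ε → Matrix ι ι ℝ) (Rl : σ → K → ε → Matrix ι ι ℝ) (κ w : ℝ) (hκ : κ = -w)
    (hXl : ∀ k e, Xl k e = κ • (Matrix.diagonal (fun x => lam (pr x)) * Cl k e - Cl k e * Matrix.diagonal (fun x => lam (pr x))) + ∑ s, lam s • Rl s k e)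
    (C : Matrix ι ι ℝ) (hC : C = ∑ k₁, ∑ e₁ ∈ O, ∑ k₂, ∑ e₂ ∈ O, h k₁ e₁ k₂ e₂ • Matrix.vecMulVec (L k₁ e₁) (L k₂ e₂) + ∑ k, ∑ e ∈ O, ℓ k e • Cl k e) :
    w • ∑ k₁, ∑ e₁ ∈ O, ∑ k₂, ∑ e₂ ∈ O, ((lam (rt k₂ e₂) - lam (rt k₁ e₁)) * h k₁ e₁ k₂ e₂) • Matrix.vecMulVec (L k₁ e₁) (L k₂ e₂) + ∑ k, ∑ e ∈ O, ℓ k e • Xl k e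
      = κ • (Matrix.diagonal (fun x => lam (pr x)) * C - C * Matrix.diagonal (fun x => lam (pr x)))
        + ∑ s, lam s • (w • ∑ k₁, ∑ e₁ ∈ O, ∑ k₂, ∑ e₂ ∈ O, h k₁ e₁ k₂ e₂ •
              (Matrix.vecMulVec (fun x => ((if pr x = s then (1 : ℝ) else 0) - (if rt k₁ e₁ = s then (1 : ℝ) else 0)) * L k₁ e₁ x) (L k₂ e₂)
                - Matrix.vecMulVec (L k₁ e₁) (fun z => ((if pr z = s then (1 : ℝ) else 0) - (if rt k₂ e₂ = s then (1 : ℝ) else 0)) * L k₂ e₂ z))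
            + ∑ k, ∑ e ∈ O, ℓ k e • Rl s k e) := by
  subst hκ
  -- push the gauge superposition inside both window sums, read the two legs, then termwise matrix algebra (as in the `Fintype` version)
  have push : ∀ (A : σ → K → ε → K → ε → Matrix ι ι ℝ) (R : σ → K → ε → Matrix ι ι ℝ),
      ∑ s, lam s • (w • ∑ k₁, ∑ e₁ ∈ O, ∑ k₂, ∑ e₂ ∈ O, h k₁ e₁ k₂ e₂ • A s k₁ e₁ k₂ e₂ + ∑ k, ∑ e ∈ O, ℓ k e • R s k e)
        = w • ∑ k₁, ∑ e₁ ∈ O, ∑ k₂, ∑ e₂ ∈ O, h k₁ e₁ k₂ e₂ • ∑ s, lam s • A s k₁ e₁ k₂ e₂ + ∑ k, ∑ e ∈ O, ℓ k e • ∑ s, lam s • R s k e := by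
    intro A R
    simp only [smul_add, Finset.smul_sum, smul_smul, Finset.sum_add_distrib]
    congr 1
    · rw [Finset.sum_comm]
      refine Finset.sum_congr rfl fun k₁ _ => ?_
      rw [Finset.sum_comm]
      refine Finset.sum_congr rfl fun e₁ _ => ?_
      rw [Finset.sum_comm]
      refine Finset.sum_congr rfl fun k₂ _ => ?_
      rw [Finset.sum_comm]
      exact Finset.sum_congr rfl fun e₂ _ => Finset.sum_congr rfl fun s _ => by rw [mul_comm (lam s), mul_assoc]
    · rw [Finset.sum_comm]
      refine Finset.sum_congr rfl fun k _ => ?_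
      rw [Finset.sum_comm]
      exact Finset.sum_congr rfl fun e _ => Finset.sum_congr rfl fun s _ => by rw [mul_comm]
  rw [push]
  simp only [smul_sub, Finset.sum_sub_distrib, sum_smul_vecMulVec_indicator_left, sum_smul_vecMulVec_indicator_right, hXl, hC]
  ext x z
  simp only [Matrix.add_apply, Matrix.sub_apply, Matrix.smul_apply, Matrix.sum_apply, diagonal_mul_vecMulVec, vecMulVec_mul_diagonal,
    Matrix.sum_mul, Matrix.mul_smul, Matrix.smul_mul, Matrix.vecMulVec_apply, smul_eq_mul,
    Finset.mul_sum, Finset.sum_add_distrib, Finset.sum_sub_distrib, mul_add, mul_sub, sub_mul, add_mul, smul_add, smul_sub]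
  simp only [neg_mul, mul_neg, Finset.sum_neg_distrib, mul_comm, mul_left_comm]
  abel

/-- [folklore] **`sum_smul_defect_indicator` — THE WRAPPER's (K2b) DISPLAY IS INHABITED BY DEFINITION; ITS CONTENT IS THE DEFECT's VALUE.**  For ANY bond-indexed
family `Mx`, table `C`, generator sites `pr` and coefficient `κ`, the defect `Def λ := Σ_b (Σ_s tg b s·λ s) • Mx b − κ•(E_λ·C − C·E_λ)` is linear in the gauge
function, so `Σ_s λ s • Def 𝟙_s = Def λ`: v6∕v7's free site-remainder family `Rs` can always be taken `:= Def 𝟙_s`, and the displayed (K2b) then holds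
identically — all content sits in the residual row (J-R₂), i.e. in the VALUE of `Def` at the road's read-outs (road [D1P3-G47-CORR-1]; v8 drops (K2b)). -/
theorem sum_smul_defect_indicator {ι' : Type*} [Fintype ι'] (pr : ι → σ) (tg : ι' → σ → ℝ) (Mx : ι' → Matrix ι ι ℝ) (C : Matrix ι ι ℝ) (κ : ℝ)
    (lam : σ → ℝ) :
    ∑ s, lam s • (∑ b, (∑ s', tg b s' * (if s' = s then (1 : ℝ) else 0)) • Mx b
        - κ • (Matrix.diagonal (fun x => if pr x = s then (1 : ℝ) else 0) * C - C * Matrix.diagonal (fun x => if pr x = s then (1 : ℝ) else 0)))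
      = ∑ b, (∑ s, tg b s * lam s) • Mx b - κ • (Matrix.diagonal (fun x => lam (pr x)) * C - C * Matrix.diagonal (fun x => lam (pr x))) := by
  ext x z
  simp only [Matrix.sum_apply, Matrix.smul_apply, Matrix.sub_apply, Matrix.mul_apply, Matrix.diagonal_apply, smul_eq_mul, mul_ite, mul_one, mul_zero,
    ite_mul, zero_mul, Finset.sum_ite_eq, Finset.sum_ite_eq', Finset.mem_univ, if_true, Finset.mul_sum, mul_sub, Finset.sum_sub_distrib]
  congr 1
  · rw [Finset.sum_comm]
    exact Finset.sum_congr rfl fun b _ => by rw [Finset.sum_mul]; exact Finset.sum_congr rfl fun s _ => by ring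
  · ring

/-- [folklore] **`wardRow_of_defect`** — the converse packaging: with `Rs s := Def 𝟙_s` the wrapper's displayed Ward row
`Σ_b (Σ_s tg b s·λ s) • Mx b = κ•(E_λ·C − C·E_λ) + Σ_s λ s • Rs s` holds for EVERY gauge function. -/
theorem wardRow_of_defect {ι' : Type*} [Fintype ι'] (pr : ι → σ) (tg : ι' → σ → ℝ) (Mx : ι' → Matrix ι ι ℝ) (C : Matrix ι ι ℝ) (κ : ℝ)
    (lam : σ → ℝ) :
    ∑ b, (∑ s, tg b s * lam s) • Mx b
      = κ • (Matrix.diagonal (fun x => lam (pr x)) * C - C * Matrix.diagonal (fun x => lam (pr x)))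
        + ∑ s, lam s • (∑ b, (∑ s', tg b s' * (if s' = s then (1 : ℝ) else 0)) • Mx b
            - κ • (Matrix.diagonal (fun x => if pr x = s then (1 : ℝ) else 0) * C - C * Matrix.diagonal (fun x => if pr x = s then (1 : ℝ) else 0))) := by
  rw [sum_smul_defect_indicator, add_sub_cancel]

end Algebra

end Summit.QuantumFields.BalabanUV.Beta.FP.TowerK2bStoreyBridge

end
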